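import Mathlib
import Summits.AnomalousDissipation.AnomalousDissipation.Theorems.DyadicWallCascadeHalfSpaceHierarchySlabExtension

/-!
# Band tools for the crux `DyadicWallCascade.HalfSpaceHierarchy` (item stmt-AnomalousDissipation-18627, line `Sketch`)
# — steady Euler and divergence on the slab from the OPEN BAND `1 < z < 2`

Registered tool stub `stub_bandEulerTools` of the lead's skeleton (`Cruxes/HalfSpaceHierarchy/Lines/Sketch.lean`,
reshape v4).  Setting: `(V, Q)` smooth on the open slab `S = {1/2 < z < 4}` of `ℝ³` (`z = X 2`) with the dilation
relation `V (2X) = V X`, `Q (2X) = Q X` for `1/2 < z < 2`.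

**Content.**
* `bandExt_fderiv_below/above`, `bandExt_gradient_below/above` — off the band the pair is `(V, Q) ∘ (2^{±1} •)` near
  every point, so `DV(X) = 2 DV(2X)` below (`1/2 < z < 1`) and `DV(X) = ½ DV(X/2)` above (`2 < z < 4`); same for `∇Q`.
* `bandExt_extend_to_planes` — a quantity continuous on the slab that vanishes off the planes `z = 1, 2` vanishes
  (vertical sequences `X ± e₂/(n+1)`, `bandExt_zero_of_vertical_limit`).
* `bandExt_euler_slab`, `bandExt_div_slab` — hence steady Euler / zero divergence on the OPEN BAND `1 < z < 2` already
  give them on the whole slab: both terms of the Euler residual scale by the same factor off the band, and the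
  residual / divergence are continuous on the slab (`bandExt_continuousOn_residual/div`, from `C^∞`).
* `stub_bandEulerTools` — the registered conjunction of the last two.

Used by `stub_slabOfBand` (`Theorems/DyadicWallCascadeHalfSpaceHierarchySlabOfBand.lean`): a BAND profile (Euler only on
the open band, no bound clause) is a SLAB profile, which `stub_slabExtension` extends to the half-space.  Folklore calculus.
-/

-- `Summit.<Summit>.<Problem>` is the tree's mandated summit-side namespace (CONVENTIONS §2); for this
-- single-conjunct summit the two coincide, so the duplicate is deliberate.
set_option linter.dupNamespace false

open scoped Topology InnerProductSpace
open MeasureTheory Filter Set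

noncomputable section

namespace Summit.AnomalousDissipation.AnomalousDissipation.Theorems.HalfSpaceHierarchy

/-! ### Derivatives outside the band from the dilation relation -/

/-- Below the band (`1/2 < z < 1`) a function with `f (2Y) = f Y` on `1/2 < z < 2` is `f ∘ (2 •)` near the
point, so its derivative is `2 • Df (2X)` (chain rule), provided `f` is smooth on the slab `1/2 < z < 4`. -/
theorem bandExt_fderiv_below {F' : Type*} [NormedAddCommGroup F'] [NormedSpace ℝ F']
    (f : EuclideanSpace ℝ (Fin 3) → F')
    (hfS : ContDiffOn ℝ ((⊤ : ℕ∞) : WithTop ℕ∞) f {Y : EuclideanSpace ℝ (Fin 3) | 1 / 2 < Y 2 ∧ Y 2 < 4})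
    (hf : ∀ Y : EuclideanSpace ℝ (Fin 3), 1 / 2 < Y 2 → Y 2 < 2 → f ((2 : ℝ) • Y) = f Y)
    {X : EuclideanSpace ℝ (Fin 3)} (h1 : 1 / 2 < X 2) (h2 : X 2 < 1) :
    fderiv ℝ f X = (2 : ℝ) • fderiv ℝ f ((2 : ℝ) • X) := by
  have hev : f =ᶠ[𝓝 X] fun Y => f ((2 : ℝ) • Y) := by
    filter_upwards [(slabExt_isOpen_band (1 / 2) 1).mem_nhds ⟨h1, h2⟩] with Y hY
    exact (hf Y hY.1 (by linarith [hY.2])).symm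
  rw [hev.fderiv_eq]
  have hmem : (2 : ℝ) • X ∈ {Y : EuclideanSpace ℝ (Fin 3) | 1 / 2 < Y 2 ∧ Y 2 < 4} := by
    simp only [mem_setOf_eq, PiLp.smul_apply, smul_eq_mul]
    constructor <;> linarith
  have hd : DifferentiableAt ℝ f ((2 : ℝ) • X) :=
    (hfS.contDiffAt ((slabExt_isOpen_band _ _).mem_nhds hmem)).differentiableAt (by simp)
  have hL : HasFDerivAt (fun Y : EuclideanSpace ℝ (Fin 3) => (2 : ℝ) • Y)
      ((2 : ℝ) • ContinuousLinearMap.id ℝ (EuclideanSpace ℝ (Fin 3))) X :=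
    (hasFDerivAt_id X).const_smul (2 : ℝ)
  have hc : HasFDerivAt (fun Y : EuclideanSpace ℝ (Fin 3) => f ((2 : ℝ) • Y))
      ((fderiv ℝ f ((2 : ℝ) • X)).comp ((2 : ℝ) • ContinuousLinearMap.id ℝ (EuclideanSpace ℝ (Fin 3)))) X :=
    hd.hasFDerivAt.comp X hL
  rw [hc.fderiv]
  ext v
  simp

/-- Above the band (`2 < z < 4`) the same relation gives `f = f ∘ (2⁻¹ •)` near the point, so the derivative
is `2⁻¹ • Df (2⁻¹ X)`. -/
theorem bandExt_fderiv_above {F' : Type*} [NormedAddCommGroup F'] [NormedSpace ℝ F']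
    (f : EuclideanSpace ℝ (Fin 3) → F')
    (hfS : ContDiffOn ℝ ((⊤ : ℕ∞) : WithTop ℕ∞) f {Y : EuclideanSpace ℝ (Fin 3) | 1 / 2 < Y 2 ∧ Y 2 < 4})
    (hf : ∀ Y : EuclideanSpace ℝ (Fin 3), 1 / 2 < Y 2 → Y 2 < 2 → f ((2 : ℝ) • Y) = f Y)
    {X : EuclideanSpace ℝ (Fin 3)} (h1 : 2 < X 2) (h2 : X 2 < 4) :
    fderiv ℝ f X = (2 : ℝ)⁻¹ • fderiv ℝ f ((2 : ℝ)⁻¹ • X) := by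
  have hev : f =ᶠ[𝓝 X] fun Y => f ((2 : ℝ)⁻¹ • Y) := by
    filter_upwards [(slabExt_isOpen_band 2 4).mem_nhds ⟨h1, h2⟩] with Y hY
    have hY1 : 1 / 2 < ((2 : ℝ)⁻¹ • Y) 2 := by
      simp only [PiLp.smul_apply, smul_eq_mul]; linarith [hY.1]
    have hY2 : ((2 : ℝ)⁻¹ • Y) 2 < 2 := by
      simp only [PiLp.smul_apply, smul_eq_mul]; linarith [hY.2]
    have h := hf ((2 : ℝ)⁻¹ • Y) hY1 hY2
    rw [smul_smul, mul_inv_cancel₀ two_ne_zero, one_smul] at h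
    exact h
  rw [hev.fderiv_eq]
  have hmem : (2 : ℝ)⁻¹ • X ∈ {Y : EuclideanSpace ℝ (Fin 3) | 1 / 2 < Y 2 ∧ Y 2 < 4} := by
    simp only [mem_setOf_eq, PiLp.smul_apply, smul_eq_mul]
    constructor <;> linarith
  have hd : DifferentiableAt ℝ f ((2 : ℝ)⁻¹ • X) :=
    (hfS.contDiffAt ((slabExt_isOpen_band _ _).mem_nhds hmem)).differentiableAt (by simp)
  have hL : HasFDerivAt (fun Y : EuclideanSpace ℝ (Fin 3) => (2 : ℝ)⁻¹ • Y)
      ((2 : ℝ)⁻¹ • ContinuousLinearMap.id ℝ (EuclideanSpace ℝ (Fin 3))) X :=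
    (hasFDerivAt_id X).const_smul ((2 : ℝ)⁻¹)
  have hc : HasFDerivAt (fun Y : EuclideanSpace ℝ (Fin 3) => f ((2 : ℝ)⁻¹ • Y))
      ((fderiv ℝ f ((2 : ℝ)⁻¹ • X)).comp ((2 : ℝ)⁻¹ • ContinuousLinearMap.id ℝ (EuclideanSpace ℝ (Fin 3)))) X :=
    hd.hasFDerivAt.comp X hL
  rw [hc.fderiv]
  ext v
  simp

/-- Gradient version of `bandExt_fderiv_below`. -/
theorem bandExt_gradient_below (f : EuclideanSpace ℝ (Fin 3) → ℝ)
    (hfS : ContDiffOn ℝ ((⊤ : ℕ∞) : WithTop ℕ∞) f {Y : EuclideanSpace ℝ (Fin 3) | 1 / 2 < Y 2 ∧ Y 2 < 4})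
    (hf : ∀ Y : EuclideanSpace ℝ (Fin 3), 1 / 2 < Y 2 → Y 2 < 2 → f ((2 : ℝ) • Y) = f Y)
    {X : EuclideanSpace ℝ (Fin 3)} (h1 : 1 / 2 < X 2) (h2 : X 2 < 1) :
    gradient f X = (2 : ℝ) • gradient f ((2 : ℝ) • X) := by
  unfold gradient
  rw [bandExt_fderiv_below f hfS hf h1 h2, map_smulₛₗ]
  simp

/-- Gradient version of `bandExt_fderiv_above`. -/
theorem bandExt_gradient_above (f : EuclideanSpace ℝ (Fin 3) → ℝ)
    (hfS : ContDiffOn ℝ ((⊤ : ℕ∞) : WithTop ℕ∞) f {Y : EuclideanSpace ℝ (Fin 3) | 1 / 2 < Y 2 ∧ Y 2 < 4})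
    (hf : ∀ Y : EuclideanSpace ℝ (Fin 3), 1 / 2 < Y 2 → Y 2 < 2 → f ((2 : ℝ) • Y) = f Y)
    {X : EuclideanSpace ℝ (Fin 3)} (h1 : 2 < X 2) (h2 : X 2 < 4) :
    gradient f X = (2 : ℝ)⁻¹ • gradient f ((2 : ℝ)⁻¹ • X) := by
  unfold gradient
  rw [bandExt_fderiv_above f hfS hf h1 h2, map_smulₛₗ]
  simp

/-! ### From the open band to the two planes `z = 1`, `z = 2` by continuity -/

/-- A function continuous on the slab that vanishes at the points `X + (σ/(n+1)) e₂`, `n ≥ 1`, of the slab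
vanishes at `X` (limit along the vertical sequence). -/
theorem bandExt_zero_of_vertical_limit {F' : Type*} [NormedAddCommGroup F']
    (R : EuclideanSpace ℝ (Fin 3) → F')
    (hR : ContinuousOn R {Y : EuclideanSpace ℝ (Fin 3) | 1 / 2 < Y 2 ∧ Y 2 < 4})
    {X : EuclideanSpace ℝ (Fin 3)} (hX : X ∈ {Y : EuclideanSpace ℝ (Fin 3) | 1 / 2 < Y 2 ∧ Y 2 < 4}) (σ : ℝ)
    (hmem : ∀ n : ℕ, 1 ≤ n →
      X + (σ / ((n : ℝ) + 1)) • EuclideanSpace.single (2 : Fin 3) (1 : ℝ) ∈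
        {Y : EuclideanSpace ℝ (Fin 3) | 1 / 2 < Y 2 ∧ Y 2 < 4})
    (hzero : ∀ n : ℕ, 1 ≤ n → R (X + (σ / ((n : ℝ) + 1)) • EuclideanSpace.single (2 : Fin 3) (1 : ℝ)) = 0) :
    R X = 0 := by
  set u : ℕ → EuclideanSpace ℝ (Fin 3) :=
    fun n => X + (σ / ((n : ℝ) + 1)) • EuclideanSpace.single (2 : Fin 3) (1 : ℝ) with hu
  have hlim : Tendsto u atTop (𝓝 X) := by
    have h0 : Tendsto (fun n : ℕ => σ / ((n : ℝ) + 1)) atTop (𝓝 0) := by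
      have h := (tendsto_one_div_add_atTop_nhds_zero_nat (𝕜 := ℝ)).const_mul σ
      rw [mul_zero] at h
      refine h.congr fun n => ?_
      ring
    have := tendsto_const_nhds (x := X) |>.add (h0.smul_const (EuclideanSpace.single (2 : Fin 3) (1 : ℝ)))
    simpa [hu] using this
  have hlimS : Tendsto u atTop (𝓝[{Y : EuclideanSpace ℝ (Fin 3) | 1 / 2 < Y 2 ∧ Y 2 < 4}] X) := by
    refine tendsto_nhdsWithin_iff.2 ⟨hlim, ?_⟩
    filter_upwards [eventually_ge_atTop 1] with n hn
    exact hmem n hn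
  have h1 : Tendsto (R ∘ u) atTop (𝓝 (R X)) := (hR X hX).tendsto.comp hlimS
  have h2 : R ∘ u =ᶠ[atTop] fun _ => 0 := by
    filter_upwards [eventually_ge_atTop 1] with n hn
    exact hzero n hn
  exact tendsto_nhds_unique (h1.congr' h2) tendsto_const_nhds


/-! ### Continuity of the Euler residual and of the divergence on the slab -/

/-- The height of a vertically shifted point. -/
theorem bandExt_vertical_coord (X : EuclideanSpace ℝ (Fin 3)) (t : ℝ) :
    (X + t • EuclideanSpace.single (2 : Fin 3) (1 : ℝ)) 2 = X 2 + t := by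
  simp

/-- `0 < 1/(n+1) ≤ 1/2` for `n ≥ 1`. -/
theorem bandExt_inv_succ_bounds (n : ℕ) (hn : 1 ≤ n) :
    0 < 1 / ((n : ℝ) + 1) ∧ 1 / ((n : ℝ) + 1) ≤ 1 / 2 := by
  have hn' : (1 : ℝ) ≤ n := by exact_mod_cast hn
  exact ⟨by positivity, one_div_le_one_div_of_le two_pos (by linarith)⟩

/-- A quantity that is continuous on the slab and vanishes off the two planes `z = 1`, `z = 2` vanishes on
the whole slab. -/
theorem bandExt_extend_to_planes {F' : Type*} [NormedAddCommGroup F'] (R : EuclideanSpace ℝ (Fin 3) → F')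
    (hR : ContinuousOn R {Y : EuclideanSpace ℝ (Fin 3) | 1 / 2 < Y 2 ∧ Y 2 < 4})
    (hopen : ∀ X : EuclideanSpace ℝ (Fin 3), 1 / 2 < X 2 → X 2 < 4 → X 2 ≠ 1 → X 2 ≠ 2 → R X = 0) :
    ∀ X ∈ {Y : EuclideanSpace ℝ (Fin 3) | 1 / 2 < Y 2 ∧ Y 2 < 4}, R X = 0 := by
  intro X hX
  obtain ⟨h1, h4⟩ := hX
  by_cases hz1 : X 2 = 1
  · refine bandExt_zero_of_vertical_limit R hR ⟨h1, h4⟩ 1 (fun n hn => ?_) (fun n hn => ?_)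
    · obtain ⟨ha, hb⟩ := bandExt_inv_succ_bounds n hn
      simp only [mem_setOf_eq, bandExt_vertical_coord, hz1]
      constructor <;> linarith
    · obtain ⟨ha, hb⟩ := bandExt_inv_succ_bounds n hn
      apply hopen <;> rw [bandExt_vertical_coord, hz1]
      · linarith
      · linarith
      · linarith
      · linarith
  · by_cases hz2 : X 2 = 2
    · refine bandExt_zero_of_vertical_limit R hR ⟨h1, h4⟩ (-1) (fun n hn => ?_) (fun n hn => ?_)
      · obtain ⟨ha, hb⟩ := bandExt_inv_succ_bounds n hn
        simp only [mem_setOf_eq, bandExt_vertical_coord, hz2, neg_div]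
        constructor <;> linarith
      · obtain ⟨ha, hb⟩ := bandExt_inv_succ_bounds n hn
        apply hopen <;> rw [bandExt_vertical_coord, hz2, neg_div]
        · linarith
        · linarith
        · linarith
        · linarith
    · exact hopen X h1 h4 hz1 hz2

/-- The Euler residual `X ↦ DV(X) V(X) + ∇Q(X)` of a smooth pair is continuous on the slab. -/
theorem bandExt_continuousOn_residual (V : EuclideanSpace ℝ (Fin 3) → EuclideanSpace ℝ (Fin 3))
    (Q : EuclideanSpace ℝ (Fin 3) → ℝ)
    (hV : ContDiffOn ℝ ((⊤ : ℕ∞) : WithTop ℕ∞) V {Y : EuclideanSpace ℝ (Fin 3) | 1 / 2 < Y 2 ∧ Y 2 < 4}) (hQ : ContDiffOn ℝ ((⊤ : ℕ∞) : WithTop ℕ∞) Q {Y : EuclideanSpace ℝ (Fin 3) | 1 / 2 < Y 2 ∧ Y 2 < 4}) :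
    ContinuousOn (fun X => (fderiv ℝ V X) (V X) + gradient Q X) {Y : EuclideanSpace ℝ (Fin 3) | 1 / 2 < Y 2 ∧ Y 2 < 4} := by
  have hS : IsOpen {Y : EuclideanSpace ℝ (Fin 3) | 1 / 2 < Y 2 ∧ Y 2 < 4} := slabExt_isOpen_band _ _
  have h1 : ContinuousOn (fun X => fderiv ℝ V X) {Y : EuclideanSpace ℝ (Fin 3) | 1 / 2 < Y 2 ∧ Y 2 < 4} := hV.continuousOn_fderiv_of_isOpen hS (by simp)
  have h3 : ContinuousOn (fun X => fderiv ℝ Q X) {Y : EuclideanSpace ℝ (Fin 3) | 1 / 2 < Y 2 ∧ Y 2 < 4} := hQ.continuousOn_fderiv_of_isOpen hS (by simp)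
  have h4 : ContinuousOn (gradient Q) {Y : EuclideanSpace ℝ (Fin 3) | 1 / 2 < Y 2 ∧ Y 2 < 4} :=
    (InnerProductSpace.toDual ℝ (EuclideanSpace ℝ (Fin 3))).symm.continuous.comp_continuousOn h3
  exact (h1.clm_apply hV.continuousOn).add h4

/-- The divergence of a smooth field is continuous on the slab. -/
theorem bandExt_continuousOn_div (V : EuclideanSpace ℝ (Fin 3) → EuclideanSpace ℝ (Fin 3))
    (hV : ContDiffOn ℝ ((⊤ : ℕ∞) : WithTop ℕ∞) V {Y : EuclideanSpace ℝ (Fin 3) | 1 / 2 < Y 2 ∧ Y 2 < 4}) :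
    ContinuousOn (fun X => ∑ i : Fin 3, (fderiv ℝ V X (EuclideanSpace.single i (1 : ℝ))) i) {Y : EuclideanSpace ℝ (Fin 3) | 1 / 2 < Y 2 ∧ Y 2 < 4} := by
  have hS : IsOpen {Y : EuclideanSpace ℝ (Fin 3) | 1 / 2 < Y 2 ∧ Y 2 < 4} := slabExt_isOpen_band _ _
  have h1 : ContinuousOn (fun X => fderiv ℝ V X) {Y : EuclideanSpace ℝ (Fin 3) | 1 / 2 < Y 2 ∧ Y 2 < 4} := hV.continuousOn_fderiv_of_isOpen hS (by simp)
  refine continuousOn_finsetSum _ fun i _ => ?_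
  have h2 : ContinuousOn (fun X => fderiv ℝ V X (EuclideanSpace.single i (1 : ℝ))) {Y : EuclideanSpace ℝ (Fin 3) | 1 / 2 < Y 2 ∧ Y 2 < 4} :=
    h1.clm_apply continuousOn_const
  exact ((continuous_apply i).comp (PiLp.continuous_ofLp 2 _)).comp_continuousOn h2

/-! ### Euler and divergence on the whole slab from the open band -/

/-- Steady Euler on the open band `1 < z < 2` plus the dilation relation gives steady Euler on the whole open
slab `1/2 < z < 4` (scale covariance off the planes, continuity on the planes). -/
theorem bandExt_euler_slab (V : EuclideanSpace ℝ (Fin 3) → EuclideanSpace ℝ (Fin 3)) (Q : EuclideanSpace ℝ (Fin 3) → ℝ)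
    (hV : ContDiffOn ℝ ((⊤ : ℕ∞) : WithTop ℕ∞) V {Y : EuclideanSpace ℝ (Fin 3) | 1 / 2 < Y 2 ∧ Y 2 < 4}) (hQ : ContDiffOn ℝ ((⊤ : ℕ∞) : WithTop ℕ∞) Q {Y : EuclideanSpace ℝ (Fin 3) | 1 / 2 < Y 2 ∧ Y 2 < 4})
    (hdil : ∀ X : EuclideanSpace ℝ (Fin 3), 1 / 2 < X 2 → X 2 < 2 →
      V ((2 : ℝ) • X) = V X ∧ Q ((2 : ℝ) • X) = Q X)
    (hE : ∀ X : EuclideanSpace ℝ (Fin 3), 1 < X 2 → X 2 < 2 → (fderiv ℝ V X) (V X) + gradient Q X = 0) :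
    ∀ X ∈ {Y : EuclideanSpace ℝ (Fin 3) | 1 / 2 < Y 2 ∧ Y 2 < 4}, (fderiv ℝ V X) (V X) + gradient Q X = 0 := by
  have hdV : ∀ Y : EuclideanSpace ℝ (Fin 3), 1 / 2 < Y 2 → Y 2 < 2 → V ((2 : ℝ) • Y) = V Y :=
    fun Y a b => (hdil Y a b).1
  have hdQ : ∀ Y : EuclideanSpace ℝ (Fin 3), 1 / 2 < Y 2 → Y 2 < 2 → Q ((2 : ℝ) • Y) = Q Y :=
    fun Y a b => (hdil Y a b).2
  refine bandExt_extend_to_planes _ (bandExt_continuousOn_residual V Q hV hQ) ?_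
  intro X h1 h4 hne1 hne2
  rcases lt_or_gt_of_ne hne1 with hlt1 | hgt1
  · -- below the band
    have h2X1 : 1 < ((2 : ℝ) • X) 2 := by simp only [PiLp.smul_apply, smul_eq_mul]; linarith
    have h2X2 : ((2 : ℝ) • X) 2 < 2 := by simp only [PiLp.smul_apply, smul_eq_mul]; linarith
    rw [bandExt_fderiv_below V hV hdV h1 hlt1, bandExt_gradient_below Q hQ hdQ h1 hlt1,
      ← hdV X h1 (by linarith), _root_.smul_apply, ← smul_add, hE _ h2X1 h2X2, smul_zero]
  · rcases lt_or_gt_of_ne hne2 with hlt2 | hgt2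
    · exact hE X hgt1 hlt2
    · -- above the band
      have hX1 : 1 < ((2 : ℝ)⁻¹ • X) 2 := by simp only [PiLp.smul_apply, smul_eq_mul]; linarith
      have hX2 : ((2 : ℝ)⁻¹ • X) 2 < 2 := by simp only [PiLp.smul_apply, smul_eq_mul]; linarith
      have hVX : V X = V ((2 : ℝ)⁻¹ • X) := by
        have h := hdV ((2 : ℝ)⁻¹ • X) (by linarith) hX2
        rw [smul_smul, mul_inv_cancel₀ two_ne_zero, one_smul] at h
        exact h
      rw [bandExt_fderiv_above V hV hdV hgt2 h4, bandExt_gradient_above Q hQ hdQ hgt2 h4, hVX,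
        _root_.smul_apply, ← smul_add, hE _ hX1 hX2, smul_zero]

/-- Divergence-freeness on the open band plus the dilation relation gives it on the whole open slab. -/
theorem bandExt_div_slab (V : EuclideanSpace ℝ (Fin 3) → EuclideanSpace ℝ (Fin 3))
    (hV : ContDiffOn ℝ ((⊤ : ℕ∞) : WithTop ℕ∞) V {Y : EuclideanSpace ℝ (Fin 3) | 1 / 2 < Y 2 ∧ Y 2 < 4})
    (hdV : ∀ X : EuclideanSpace ℝ (Fin 3), 1 / 2 < X 2 → X 2 < 2 → V ((2 : ℝ) • X) = V X)
    (hdiv : ∀ X : EuclideanSpace ℝ (Fin 3), 1 < X 2 → X 2 < 2 →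
      ∑ i : Fin 3, (fderiv ℝ V X (EuclideanSpace.single i (1 : ℝ))) i = 0) :
    ∀ X ∈ {Y : EuclideanSpace ℝ (Fin 3) | 1 / 2 < Y 2 ∧ Y 2 < 4}, ∑ i : Fin 3, (fderiv ℝ V X (EuclideanSpace.single i (1 : ℝ))) i = 0 := by
  refine bandExt_extend_to_planes _ (bandExt_continuousOn_div V hV) ?_
  intro X h1 h4 hne1 hne2
  rcases lt_or_gt_of_ne hne1 with hlt1 | hgt1
  · have h2X1 : 1 < ((2 : ℝ) • X) 2 := by simp only [PiLp.smul_apply, smul_eq_mul]; linarith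
    have h2X2 : ((2 : ℝ) • X) 2 < 2 := by simp only [PiLp.smul_apply, smul_eq_mul]; linarith
    simp only [bandExt_fderiv_below V hV hdV h1 hlt1, _root_.smul_apply, PiLp.smul_apply, smul_eq_mul,
      ← Finset.mul_sum]
    rw [hdiv _ h2X1 h2X2, mul_zero]
  · rcases lt_or_gt_of_ne hne2 with hlt2 | hgt2
    · exact hdiv X hgt1 hlt2
    · have hX1 : 1 < ((2 : ℝ)⁻¹ • X) 2 := by simp only [PiLp.smul_apply, smul_eq_mul]; linarith
      have hX2 : ((2 : ℝ)⁻¹ • X) 2 < 2 := by simp only [PiLp.smul_apply, smul_eq_mul]; linarith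
      simp only [bandExt_fderiv_above V hV hdV hgt2 h4, _root_.smul_apply, PiLp.smul_apply, smul_eq_mul,
        ← Finset.mul_sum]
      rw [hdiv _ hX1 hX2, mul_zero]

/-- **Registered tool stub `stub_bandEulerTools`** (conjunction of `bandExt_euler_slab` and `bandExt_div_slab`):
steady Euler, resp. zero divergence, on the open band `1 < z < 2` plus the dilation relation give the same on the
whole open slab `1/2 < z < 4`. -/
theorem stub_bandEulerTools :
    (∀ (V : EuclideanSpace ℝ (Fin 3) → EuclideanSpace ℝ (Fin 3)) (Q : EuclideanSpace ℝ (Fin 3) → ℝ),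
      ContDiffOn ℝ ((⊤ : ℕ∞) : WithTop ℕ∞) V {Y : EuclideanSpace ℝ (Fin 3) | 1 / 2 < Y 2 ∧ Y 2 < 4} →
      ContDiffOn ℝ ((⊤ : ℕ∞) : WithTop ℕ∞) Q {Y : EuclideanSpace ℝ (Fin 3) | 1 / 2 < Y 2 ∧ Y 2 < 4} →
      (∀ X : EuclideanSpace ℝ (Fin 3), 1 / 2 < X 2 → X 2 < 2 → V ((2 : ℝ) • X) = V X ∧ Q ((2 : ℝ) • X) = Q X) →
      (∀ X : EuclideanSpace ℝ (Fin 3), 1 < X 2 → X 2 < 2 → (fderiv ℝ V X) (V X) + gradient Q X = 0) →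
      ∀ X ∈ {Y : EuclideanSpace ℝ (Fin 3) | 1 / 2 < Y 2 ∧ Y 2 < 4}, (fderiv ℝ V X) (V X) + gradient Q X = 0) ∧
    (∀ (V : EuclideanSpace ℝ (Fin 3) → EuclideanSpace ℝ (Fin 3)),
      ContDiffOn ℝ ((⊤ : ℕ∞) : WithTop ℕ∞) V {Y : EuclideanSpace ℝ (Fin 3) | 1 / 2 < Y 2 ∧ Y 2 < 4} →
      (∀ X : EuclideanSpace ℝ (Fin 3), 1 / 2 < X 2 → X 2 < 2 → V ((2 : ℝ) • X) = V X) →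
      (∀ X : EuclideanSpace ℝ (Fin 3), 1 < X 2 → X 2 < 2 → ∑ i : Fin 3, (fderiv ℝ V X (EuclideanSpace.single i (1 : ℝ))) i = 0) →
      ∀ X ∈ {Y : EuclideanSpace ℝ (Fin 3) | 1 / 2 < Y 2 ∧ Y 2 < 4}, ∑ i : Fin 3, (fderiv ℝ V X (EuclideanSpace.single i (1 : ℝ))) i = 0) :=
  ⟨fun V Q hV hQ hdil hE => bandExt_euler_slab V Q hV hQ hdil hE,
    fun V hV hdV hdiv => bandExt_div_slab V hV hdV hdiv⟩

end Summit.AnomalousDissipation.AnomalousDissipation.Theorems.HalfSpaceHierarchy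

end
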